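import Summits.Ventures.PercRepro.RankLevelSetBiIndepContainNorm
import Summits.Ventures.PercRepro.RankLevelSetBiIndepContainNormPaving
import Summits.Ventures.PercRepro.RankLevelSetBiIndepContainNormTruncate

/-! # RankLevelSetBiIndepContainNormClass — THE (CUM-norm)-CLASS IN THE `Prop` VOCABULARY: PAVING MATROIDS AND THEIR
TRUNCATIONS SATISFY `BiContainNormSkew`; HENCE THE CUMULATIVE (CX*) ON EVERY CONTAIN-SET FOR THEM (night-1 g30; dossier §42.20)

Wrappers of the unfolded theorems `biContainNormSkew_of_paving'` and `biContainNormSkew_truncateTo'` against the `Prop`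
`BiContainNormSkew` of `RankLevelSetBiIndepContainNorm`, and their consequence through `minorPairSkew_contain_of_normSkew`:
every paving matroid, and every truncation of a matroid satisfying (CUM-norm), satisfies the cumulative (CX*) on every
contain-set. Every declaration has a docstring; imports: the cell's own modules and Mathlib only. Axioms: standard. -/

namespace PercRepro

open Set Matroid

variable {α : Type} (M : Matroid α) [M.Finite]

/-- **Every paving matroid satisfies (CUM-norm).** -/
theorem biContainNormSkew_of_paving (h : Paving M) {r : ℕ} (hr : M.eRank = r) : BiContainNormSkew M :=
  biContainNormSkew_of_paving' M h hr

/-- **(CUM-norm) is closed under truncation.** -/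
theorem biContainNormSkew_truncateTo (h : BiContainNormSkew M) (k : ℕ) :
    haveI := truncateTo_finite M k
    BiContainNormSkew (truncateTo M k) :=
  biContainNormSkew_truncateTo' M h k

/-- **Every paving matroid satisfies the cumulative (CX*) on every contain-set** (through (CUM-norm)). -/
theorem minorPairSkew_contain_of_paving (h : Paving M) {r : ℕ} (hr : M.eRank = r) :
    ∀ X ⊆ M.E, MinorPairSkew M X ∅ (M.E.ncard - 2 * X.ncard - 1) :=
  minorPairSkew_contain_of_normSkew M (biContainNormSkew_of_paving M h hr)

/-- **Every truncation of a matroid with (CUM-norm) satisfies the cumulative (CX*) on every contain-set.** -/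
theorem minorPairSkew_contain_truncateTo_of_normSkew (h : BiContainNormSkew M) (k : ℕ) :
    haveI := truncateTo_finite M k
    ∀ X ⊆ (truncateTo M k).E, MinorPairSkew (truncateTo M k) X ∅ ((truncateTo M k).E.ncard - 2 * X.ncard - 1) :=
  haveI := truncateTo_finite M k
  minorPairSkew_contain_of_normSkew (truncateTo M k) (biContainNormSkew_truncateTo M h k)

end PercRepro
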